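import Summits.QuantumAdvantage.QuantumAdvantage.Theorems.SparsityDialRungB

/-! # SparsityDialRung — part 3/3 (mechanical split for landing of `SparsityDialRung`; content verbatim; scopes re-opened with their variables) -/

set_option linter.dupNamespace false
set_option linter.unusedVariables false
noncomputable section
open scoped Classical

namespace Summit.QuantumAdvantage.QuantumAdvantage.Theorems.SparsityDial
open Finset
open Literature.Computability.QuantumComplexity Literature.Computability.QuantumComplexity.RingHLF
open Literature.Computability.MetaComplexity Literature.Computability.MetaComplexity.Smolensky
open Summit.QuantumAdvantage.AdviceFreeQNC0
open Summit.QuantumAdvantage.QuantumAdvantage.Theses (ExactnessDial.PolyLossOddU3 ExactnessDial.DPLift3)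
open Summit.QuantumAdvantage.QuantumAdvantage.Theorems.HolonomyDial (selP selP_mem selP_apply xorP xorP_mem
  xorP_apply_bool tPoly tPoly_mem tPoly_apply closes_T)
open Summit.QuantumAdvantage.QuantumAdvantage.Theorems.AnchorDial (outB dev loss_shape_mono card_odd_ge flip2 flip2_apply_of_ne
  Frozen OneGap frozen_loss_count)
open Summit.QuantumAdvantage.QuantumAdvantage.Theorems.HolonomyDial (card_odd_le)
open Summit.QuantumAdvantage.QuantumAdvantage.Theorems.LocusDial (Coverable FewLocus FewLocusLossOne3
  coverable_mono_m Coverable.card_le dev_tPoly fewLocusLossOne3_of_fewLocusLoss3)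
open Summit.QuantumAdvantage.QuantumAdvantage.Theorems.StabilizerDial (StabFew pad pad_mem winset_pad deg_pad_stab
  stabFew_of_fewLocus bitP bitP_pad rowMask apIdx apStrat apStrat_mem bitP_apStrat mem_dev_pad_apStrat_iff BlockRec
  fibreIdentityAt_of_block oddSliceBound_holds goodBound_of_blockRec blockSelect_of_fewLocus eventually_polylog
  side_bounds polyLossOddU3_of_stabPos stabGenericLossPos3_of_polyLossOddU3 antipodalGenericPos3)
variable {N : ℕ}

/-! ## §5c  THE FROZEN-16 LAW (new; level 0 of the sensitivity dial, NO gap hypothesis, NO degree hypothesis).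
If a strategy's deviation set is the same at the sixteen points of the orbit of FOUR separated adjacent pair-flips
(`AnchorDial.orb`), the strategy loses at one of the sixteen points; hence `#{odd, orbit-frozen} ≤ 16 · #{odd losers}`.
Mechanism: along the orbit the kernel phase of position `k` moves by `Σ_i ε_i (1 + [b_i < k]) σ_i` (`cN_orb`), so the
positions fall into five GROUPS (number of flip sites passed); per group the exclusion parities
`v ↦ #{k : c_k + v ≢ 2} mod 2` form one of the four EVEN patterns on `ℤ/3` (`three_counts`); a finite check
(`core_frozen16`, `decide`: 16 sign vectors × 4⁵ pattern choices) shows no choice wins at all sixteen points.  (With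
two flips and a middle group there ARE all-win configurations — the landed one-gap law is sharp for two flips.)
Corollary: the ANTI-CANONICAL family `1 − t` (deviation set = the whole ring) wins `≤ 15/16` of the odd class —
`acLoss3`, the first loss theorem for a deviation pattern that wraps the whole cycle.  Reading for the programme: a
near-perfect strategy's deviation pattern must be SENSITIVE to every separated quadruple of adjacent pairs on all but an
`n^{-C}`-fraction of inputs. -/

section Frozen16

open Summit.QuantumAdvantage.QuantumAdvantage.Theorems.AnchorDial (orb sh sgN cN cN_orb oddZeros_orb
  card_exists_orb_le win_iff gCond_iff_cN three_counts)
open Summit.QuantumAdvantage.QuantumAdvantage.Theorems.AnchorDial.Core (B4)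
open Summit.QuantumAdvantage.QuantumAdvantage.Theorems.HolonomyDial (gCond)
open Summit.QuantumAdvantage.QuantumAdvantage.Theorems.LocusDial (acStrat acStrat_mem dev_acStrat)

/-- the four EVEN parity patterns on `ℤ/3`, as Boolean functions of `v mod 3` (`0`: identically even). -/
def epat (i : Fin 4) (v : ℕ) : Bool :=
  if i.val = 0 then false
  else if i.val = 1 then decide (v % 3 ≠ 0)
  else if i.val = 2 then decide (v % 3 ≠ 1)
  else decide (v % 3 ≠ 2)

/-- the phase shift seen by GROUP `g` (number of flip sites already passed) at orbit point `ε` with signs `z`. -/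
def shiftAt (ε : B4) (g : ℕ) (z : B4) : ℕ :=
  sh ε.1 (decide (1 ≤ g)) z.1 + sh ε.2.1 (decide (2 ≤ g)) z.2.1 +
    sh ε.2.2.1 (decide (3 ≤ g)) z.2.2.1 + sh ε.2.2.2 (decide (4 ≤ g)) z.2.2.2

/-- **FINITE CORE of the frozen-16 law**: for every sign vector and every choice of even patterns for the five
groups, some orbit point has EVEN total parity. -/
theorem core_frozen16 (z₁ z₂ z₃ z₄ : Bool) : ∀ q₀ q₁ q₂ q₃ q₄ : Fin 4, ∃ e₁ e₂ e₃ e₄ : Bool,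
    ((epat q₀ (shiftAt (e₁, e₂, e₃, e₄) 0 (z₁, z₂, z₃, z₄))).toNat
      + (epat q₁ (shiftAt (e₁, e₂, e₃, e₄) 1 (z₁, z₂, z₃, z₄))).toNat
      + (epat q₂ (shiftAt (e₁, e₂, e₃, e₄) 2 (z₁, z₂, z₃, z₄))).toNat
      + (epat q₃ (shiftAt (e₁, e₂, e₃, e₄) 3 (z₁, z₂, z₃, z₄))).toNat
      + (epat q₄ (shiftAt (e₁, e₂, e₃, e₄) 4 (z₁, z₂, z₃, z₄))).toNat) % 2 = 0 := by
  cases z₁ <;> cases z₂ <;> cases z₃ <;> cases z₄ <;> decide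

/-- the GROUP of a position: how many of the four flip sites it has passed. -/
def grpOf (b₁ b₂ b₃ b₄ k : ℕ) : ℕ :=
  (if b₁ + 1 ≤ k then 1 else 0) + (if b₂ + 1 ≤ k then 1 else 0) +
    (if b₃ + 1 ≤ k then 1 else 0) + (if b₄ + 1 ≤ k then 1 else 0)

/-- SparsityDialRung helper `grpOf_le` (decomp-qadv land package; see the module docstring). -/
theorem grpOf_le (b₁ b₂ b₃ b₄ k : ℕ) : grpOf b₁ b₂ b₃ b₄ k ≤ 4 := by
  unfold grpOf
  split_ifs <;> omega

/-- SparsityDialRung helper `shift_eq_shiftAt` (decomp-qadv land package; see the module docstring). -/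
theorem shift_eq_shiftAt {b₁ b₂ b₃ b₄ : ℕ} (h12 : b₁ + 2 ≤ b₂) (h23 : b₂ + 2 ≤ b₃) (h34 : b₃ + 2 ≤ b₄)
    (ε : B4) (z₁ z₂ z₃ z₄ : Bool) (k : ℕ) :
    sh ε.1 (decide (b₁ + 1 ≤ k)) z₁ + sh ε.2.1 (decide (b₂ + 1 ≤ k)) z₂ + sh ε.2.2.1 (decide (b₃ + 1 ≤ k)) z₃
      + sh ε.2.2.2 (decide (b₄ + 1 ≤ k)) z₄ = shiftAt ε (grpOf b₁ b₂ b₃ b₄ k) (z₁, z₂, z₃, z₄) := by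
  unfold shiftAt grpOf
  by_cases h1 : b₁ + 1 ≤ k <;> by_cases h2 : b₂ + 1 ≤ k <;> by_cases h3 : b₃ + 1 ≤ k <;> by_cases h4 : b₄ + 1 ≤ k
  all_goals first | (exfalso; omega) | simp [h1, h2, h3, h4]

/-- every finite family of phases has one of the four even exclusion-parity patterns. -/
theorem exists_epat {α : Type*} (W : Finset α) (c : α → ℕ) : ∃ i : Fin 4, ∀ v : ℕ,
    (W.filter fun k => (c k + v) % 3 ≠ 2).card % 2 = (epat i v).toNat := by
  set n : ℕ → ℕ := fun t => (W.filter fun k => (c k + t) % 3 ≠ 2).card with hn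
  have hper : ∀ t, n t = n (t % 3) := by
    intro t
    simp only [hn]
    congr 1
    refine filter_congr fun k _ => ?_
    constructor <;> intro h <;> omega
  have hsum : n 0 + n 1 + n 2 = 2 * W.card := three_counts W c
  have hv3 : ∀ v : ℕ, v % 3 = 0 ∨ v % 3 = 1 ∨ v % 3 = 2 := fun v => by omega
  have goal : ∀ i : Fin 4, (n 0 % 2 = (epat i 0).toNat) → (n 1 % 2 = (epat i 1).toNat) →
      (n 2 % 2 = (epat i 2).toNat) → ∀ v : ℕ, n v % 2 = (epat i v).toNat := by
    intro i h0 h1 h2 v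
    have hpv : epat i v = epat i (v % 3) := by simp only [epat, Nat.mod_mod]
    rw [hper v, hpv]
    rcases hv3 v with hv | hv | hv <;> rw [hv]
    · exact h0
    · exact h1
    · exact h2
  by_cases h0 : n 0 % 2 = 0
  · by_cases h1 : n 1 % 2 = 0
    · exact ⟨⟨0, by norm_num⟩, goal _ (by simp [epat]; omega) (by simp [epat]; omega) (by simp [epat]; omega)⟩
    · exact ⟨⟨1, by norm_num⟩, goal _ (by simp [epat]; omega) (by simp [epat]; omega) (by simp [epat]; omega)⟩
  · by_cases h1 : n 1 % 2 = 0
    · exact ⟨⟨2, by norm_num⟩, goal _ (by simp [epat]; omega) (by simp [epat]; omega) (by simp [epat]; omega)⟩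
    · exact ⟨⟨3, by norm_num⟩, goal _ (by simp [epat]; omega) (by simp [epat]; omega) (by simp [epat]; omega)⟩

/-- the four hidden SIGNS of `x` at the flip sites. -/
def zV (b₁ b₂ b₃ b₄ : ℕ) (x : Fin N → Bool) : B4 :=
  (zpar x (b₁ + 1), zpar x (b₂ + 1), zpar x (b₃ + 1), zpar x (b₄ + 1))

/-- **THE FROZEN-16 LAW (pointwise)**: an orbit-frozen deviation set loses at one of the sixteen orbit points. -/
theorem frozen16_orbit_loses (hN : 3 ≤ N) {b₁ b₂ b₃ b₄ : ℕ} (h12 : b₁ + 2 ≤ b₂) (h23 : b₂ + 2 ≤ b₃)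
    (h34 : b₃ + 2 ≤ b₄) (h4N : b₄ + 3 ≤ N) (P : Fin N → CubeFn (ZMod 3) N) (x : Fin N → Bool) (hx : OddZeros x)
    (hF : ∀ ε : B4, dev P (orb b₁ b₂ b₃ b₄ ε x) = dev P x) :
    ∃ ε : B4, ¬ Rel (orb b₁ b₂ b₃ b₄ ε x) (outB P (orb b₁ b₂ b₃ b₄ ε x)) := by
  set w := dev P x with hw
  set W : ℕ → Finset (Fin N) := fun g => w.filter fun k => grpOf b₁ b₂ b₃ b₄ k.val = g with hW
  have hq : ∀ g : ℕ, ∃ i : Fin 4, ∀ v : ℕ,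
      ((W g).filter fun k => (cN x k.val + v) % 3 ≠ 2).card % 2 = (epat i v).toNat :=
    fun g => exists_epat (W g) fun k => cN x k.val
  choose q hq using hq
  obtain ⟨e₁, e₂, e₃, e₄, hcore⟩ := core_frozen16 (zpar x (b₁ + 1)) (zpar x (b₂ + 1)) (zpar x (b₃ + 1))
    (zpar x (b₄ + 1)) (q 0) (q 1) (q 2) (q 3) (q 4)
  refine ⟨(e₁, e₂, e₃, e₄), fun hwin => ?_⟩
  have ho : OddZeros (orb b₁ b₂ b₃ b₄ (e₁, e₂, e₃, e₄) x) :=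
    (oddZeros_orb (by omega) (by omega) (by omega) (by omega) _ x).2 hx
  rw [win_iff hN P _ ho, hF] at hwin
  -- the phases along the orbit, grouped
  have hphase : ∀ k : Fin N, gCond (orb b₁ b₂ b₃ b₄ (e₁, e₂, e₃, e₄) x) k.val ↔
      (cN x k.val + shiftAt (e₁, e₂, e₃, e₄) (grpOf b₁ b₂ b₃ b₄ k.val) (zV b₁ b₂ b₃ b₄ x)) % 3 ≠ 2 := by
    intro k
    rw [gCond_iff_cN]
    have h1 := cN_orb x h12 h23 h34 h4N (e₁, e₂, e₃, e₄) k.val (by omega)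
    have h2 := shift_eq_shiftAt h12 h23 h34 (e₁, e₂, e₃, e₄) (zpar x (b₁ + 1)) (zpar x (b₂ + 1))
      (zpar x (b₃ + 1)) (zpar x (b₄ + 1)) k.val
    simp only [zV]
    simp only at h1 h2
    constructor <;> intro h <;> omega
  have hfilt : (w.filter fun k => gCond (orb b₁ b₂ b₃ b₄ (e₁, e₂, e₃, e₄) x) k.val) =
      w.filter fun k => (cN x k.val + shiftAt (e₁, e₂, e₃, e₄) (grpOf b₁ b₂ b₃ b₄ k.val)
        (zV b₁ b₂ b₃ b₄ x)) % 3 ≠ 2 :=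
    filter_congr fun k _ => hphase k
  rw [hfilt] at hwin
  -- fiberwise over the five groups
  have hfib := card_eq_sum_card_fiberwise (f := fun k : Fin N => grpOf b₁ b₂ b₃ b₄ k.val)
      (s := w.filter fun k => (cN x k.val + shiftAt (e₁, e₂, e₃, e₄) (grpOf b₁ b₂ b₃ b₄ k.val)
        (zV b₁ b₂ b₃ b₄ x)) % 3 ≠ 2)
      (t := range 5) (fun k _ => mem_range.mpr (Nat.lt_succ_of_le (grpOf_le b₁ b₂ b₃ b₄ k.val)))
  have hfibg : ∀ g ∈ range 5,
      ((w.filter fun k => (cN x k.val + shiftAt (e₁, e₂, e₃, e₄) (grpOf b₁ b₂ b₃ b₄ k.val)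
        (zV b₁ b₂ b₃ b₄ x)) % 3 ≠ 2).filter fun k => grpOf b₁ b₂ b₃ b₄ k.val = g)
        = (W g).filter fun k => (cN x k.val + shiftAt (e₁, e₂, e₃, e₄) g (zV b₁ b₂ b₃ b₄ x)) % 3 ≠ 2 := by
    intro g _
    ext k
    simp only [hW, mem_filter]
    constructor
    · rintro ⟨⟨hk, h⟩, hg⟩
      rw [hg] at h
      exact ⟨⟨hk, hg⟩, h⟩
    · rintro ⟨⟨hk, hg⟩, h⟩
      rw [← hg] at h
      exact ⟨⟨hk, h⟩, hg⟩
  rw [hfib, sum_congr rfl (fun g hg => by rw [hfibg g hg]), Finset.sum_nat_mod,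
    sum_congr rfl (fun g _ => hq g (shiftAt (e₁, e₂, e₃, e₄) g (zV b₁ b₂ b₃ b₄ x)))] at hwin
  rw [Finset.sum_range_succ, Finset.sum_range_succ, Finset.sum_range_succ, Finset.sum_range_succ,
    Finset.sum_range_one] at hwin
  simp only [zV] at hwin
  omega

/-- **THE FROZEN-16 LAW (counting)**: `#{odd, orbit-frozen} ≤ 16 · #{odd losers}` — no gap, no degree hypothesis. -/
theorem frozen16_loss_count (hN : 3 ≤ N) {b₁ b₂ b₃ b₄ : ℕ} (h12 : b₁ + 2 ≤ b₂) (h23 : b₂ + 2 ≤ b₃)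
    (h34 : b₃ + 2 ≤ b₄) (h4N : b₄ + 3 ≤ N) (P : Fin N → CubeFn (ZMod 3) N) :
    (univ.filter fun x : Fin N → Bool =>
        OddZeros x ∧ ∀ ε : B4, dev P (orb b₁ b₂ b₃ b₄ ε x) = dev P x).card ≤
      16 * (univ.filter fun x : Fin N → Bool => OddZeros x ∧ ¬ Rel x (outB P x)).card := by
  refine le_trans (card_le_card fun x hx => ?_)
    (card_exists_orb_le b₁ b₂ b₃ b₄ (fun y : Fin N → Bool => OddZeros y ∧ ¬ Rel y (outB P y)))
  rw [mem_filter] at hx ⊢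
  obtain ⟨-, hodd, hF⟩ := hx
  obtain ⟨ε, hε⟩ := frozen16_orbit_loses hN h12 h23 h34 h4N P x hodd hF
  exact ⟨mem_univ _, ε, (oddZeros_orb (by omega) (by omega) (by omega) (by omega) ε x).2 hodd, hε⟩

/-- from `#odd ≤ M · #odd-losers` to the real-valued loss form with `C = 1` (`n ≥ M`). -/
theorem real_loss_of_frac {n M : ℕ} (hM : 1 ≤ M) (hMn : M ≤ n) (h3 : 3 ≤ n) (P : Fin n → CubeFn (ZMod 3) n)
    (hq : (univ.filter fun x : Fin n → Bool => OddZeros x).card ≤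
      M * (univ.filter fun x : Fin n → Bool => OddZeros x ∧ ¬ Rel x (outB P x)).card) :
    ((univ.filter fun x : Fin n → Bool => OddZeros x ∧ Rel x (fun i => decide (P i x = 1))).card : ℝ) ≤
      (1 - 1 / (n : ℝ) ^ 1) * (2 : ℝ) ^ (n - 1) := by
  set W := (univ.filter fun x : Fin n → Bool =>
    OddZeros x ∧ Rel x (fun i => decide (P i x = 1))).card with hW
  set Lo := (univ.filter fun x : Fin n → Bool =>
    OddZeros x ∧ ¬ Rel x (fun i => decide (P i x = 1))).card with hLo
  set O := (univ.filter fun x : Fin n → Bool => OddZeros x).card with hO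
  have hq' : O ≤ M * Lo := hq
  have hsplit : W + Lo = O := by
    have hs := Finset.card_filter_add_card_filter_not
      (s := univ.filter fun x : Fin n → Bool => OddZeros x)
      (fun x : Fin n → Bool => Rel x (fun i => decide (P i x = 1)))
    rw [filter_filter, filter_filter] at hs
    exact hs
  have hOle : O ≤ 2 ^ (n - 1) := card_odd_le (n := n) (by omega)
  have hkey : M * W + O ≤ M * O := by
    have : M * O = M * W + M * Lo := by rw [← hsplit, mul_add]
    omega
  have hM' : (1 : ℝ) ≤ M := by exact_mod_cast hM
  have hMn' : (M : ℝ) ≤ n := by exact_mod_cast hMn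
  have hkey' : (M : ℝ) * W + O ≤ M * O := by exact_mod_cast hkey
  have hOle' : (O : ℝ) ≤ (2 : ℝ) ^ (n - 1) := by exact_mod_cast hOle
  have hMpos : (0 : ℝ) < M := by linarith
  rw [pow_one]
  have hW1 : (W : ℝ) ≤ O - O / M := by
    have h : (O : ℝ) / M * M = O := div_mul_cancel₀ _ (ne_of_gt hMpos)
    nlinarith [hkey', h, hMpos]
  have hfac1 : (0 : ℝ) ≤ 1 - 1 / M := by
    rw [sub_nonneg, div_le_one hMpos]
    exact hM'
  have hfac2 : 1 - 1 / (M : ℝ) ≤ 1 - 1 / n := by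
    have := one_div_le_one_div_of_le hMpos hMn'
    linarith
  calc (W : ℝ) ≤ O - O / M := hW1
    _ = (1 - 1 / M) * O := by ring
    _ ≤ (1 - 1 / M) * (2 : ℝ) ^ (n - 1) := mul_le_mul_of_nonneg_left hOle' hfac1
    _ ≤ (1 - 1 / n) * (2 : ℝ) ^ (n - 1) := mul_le_mul_of_nonneg_right hfac2 (by positivity)

/-- **COROLLARY**: the anti-canonical family `1 − t` (deviation set = the whole ring, trivially orbit-frozen) has at
least a SIXTEENTH of the odd class as losers (`N ≥ 9`; flip sites `0, 2, 4, 6`). -/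
theorem acStrat_sixteenth_loss (hN : 9 ≤ N) :
    (univ.filter fun x : Fin N → Bool => OddZeros x).card ≤
      16 * (univ.filter fun x : Fin N → Bool =>
        OddZeros x ∧ ¬ Rel x (outB (fun i : Fin N => acStrat i) x)).card := by
  have h := frozen16_loss_count (N := N) (by omega) (b₁ := 0) (b₂ := 2) (b₃ := 4) (b₄ := 6)
    (by norm_num) (by norm_num) (by norm_num) (by omega) (fun i : Fin N => acStrat i)
  have heq : (univ.filter fun x : Fin N → Bool => OddZeros x) = univ.filter fun x : Fin N → Bool =>
      OddZeros x ∧ ∀ ε : B4, dev (fun i : Fin N => acStrat i) (orb 0 2 4 6 ε x) =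
        dev (fun i : Fin N => acStrat i) x := by
    refine filter_congr fun x _ => ?_
    simp only [dev_acStrat, implies_true, and_true]
  rw [heq]
  exact h

/-- **`AcLoss3` (typed)**: the anti-canonical family is NOT near-perfect. -/
def AcLoss3 : Prop :=
  ∃ C n₀ : ℕ, ∀ n ≥ n₀,
    ((univ.filter fun x : Fin n → Bool => OddZeros x ∧ Rel x (fun i => decide (acStrat i x = 1))).card : ℝ) ≤
      (1 - 1 / (n : ℝ) ^ C) * (2 : ℝ) ^ (n - 1)

/-- **PROVED** (`C = 1`, `n ≥ 16`; the frozen-16 law). -/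
theorem acLoss3 : AcLoss3 :=
  ⟨1, 16, fun n hn => real_loss_of_frac (M := 16) (by norm_num) hn (by omega) _
    (acStrat_sixteenth_loss (N := n) (by omega))⟩

end Frozen16

end Summit.QuantumAdvantage.QuantumAdvantage.Theorems.SparsityDial
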